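import Summits.NavierStokesRegularity.NavierStokesRegularity.Theorems.SqueezeCycleRecurrentLiouvilleNearIdentityDSS
import Summits.NavierStokesRegularity.NavierStokesRegularity.Theorems.RecurrentProfilesRecurrentReductionOrbit
import HarnessLib

/-!
# Crux `RecurrentLiouville` (stmt-NavierStokesRegularity-1589), line `Sketch` (skeleton v9) — harvest
  stub `stub_prStabilizerOfLimit`: a.e. scaling symmetries pass to `L³_loc` limits of rescalings

Theorems-only support file (no definitions, no named facts).

**Statement.**  Let `u, v : ℝ × ℝ³ → ℝ³` (time first) lie in `L³(Q(0, R))` for every backward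
parabolic ball `Q(0, R) = (−R², 0) × B_R(0)`, `R > 0`, let `λₙ > 0`, and suppose that the
Navier–Stokes rescalings `u_{λₙ}(t, x) = λₙ u(λₙ² t, λₙ x)` (`nsRescale (lam n) u`) converge to `v`
in every `L³(Q(0, R))`.  Then every almost-everywhere scaling symmetry of `u` is one of `v`: if
`u_{e^σ} = u` a.e. on the backward slab `ℝ₋ × ℝ³`, then `v_{e^σ} = v` a.e. on the slab.  In words,
the SCALING STABILISER `Stab(u) = {σ | u_{e^σ} = u a.e. on the slab}` can only grow along the
`L³_loc` orbit closure: `Stab(u) ⊆ Stab(v)` (upper semicontinuity of the stabiliser on the hull of a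
Type-I singularity model, in the `L³_loc` setting of Albritton–Barker 2019, §3).

**Proof.**  Put `c = e^σ > 0`.  Both `v` and `v_c` are limits in every `L³(Q(0, n+1))` of the SAME
sequence `u_{λₙ}`, hence they agree a.e. on the slab (`ae_eq_lowerHalf_of_tendsto_eLpNorm`: the
balls `Q(0, n+1)` exhaust the slab and `L³` limits are a.e. unique).  Indeed `u_c = u` a.e. on the
slab transports along the parabolic dilation by `λₙ` (`rlNearIdentityDSS_ae_comp_dilation`) to
`(u_{λₙ})_c = (u_c)_{λₙ} = u_{λₙ}` a.e. on the slab (rescalings commute, `nsRescale_comm`), hence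
a.e. on every ball (`Q(0, R) ⊆ ℝ₋ × ℝ³`), so that by the exact scaling law of `L³` distances
(`eLpNorm_zoom_sub_zoom`)
`‖u_{λₙ} − v_c‖_{L³(Q(0,R))} = ‖(u_{λₙ})_c − v_c‖_{L³(Q(0,R))} = c (c⁵)^{-1/3} ‖u_{λₙ} − v‖_{L³(Q(0, cR))} → 0`.

## References

* D. Albritton, T. Barker, *Global weak Besov solutions of the Navier–Stokes equations and
  applications*, J. Math. Fluid Mech. 21 (2019), no. 43 = arXiv:1811.00502, §3 (the setting:
  `L³_loc` limits of rescaled Type-I solutions on the backward slab). [AlbrittonBarker2019]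
* The scaling bookkeeping itself is elementary. [folklore]
-/

noncomputable section

-- the sub-problem namespace repeats the summit name (D-0017 layout `Summit.<S>.<P>.Theorems`)
set_option linter.dupNamespace false

namespace Summit.NavierStokesRegularity.NavierStokesRegularity.Theorems

open MeasureTheory Set Function Filter Topology TopologicalSpace Metric
open Literature.Analysis Literature.Analysis.FluidPDE
open scoped NNReal ENNReal

/-- **Transport of an a.e. scaling symmetry to a rescaling.**  If `u_c = u` a.e. on the backward
slab and `λ > 0`, then `(u_λ)_c = u_λ` a.e. on the slab: rescalings commute (`(u_λ)_c = (u_c)_λ`),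
and the identity `u_c = u` transports along the non-singular, slab-preserving parabolic dilation
`(t, x) ↦ (λ² t, λ x)`. [folklore] -/
theorem prSL_ae_nsRescale_comm_of_ae
    {u : ℝ → EuclideanSpace ℝ (Fin 3) → EuclideanSpace ℝ (Fin 3)} {c lam : ℝ} (hlam : 0 < lam)
    (h : ∀ᵐ z ∂(volume.restrict (Iio (0 : ℝ) ×ˢ (univ : Set (EuclideanSpace ℝ (Fin 3))))),
      nsRescale c u z.1 z.2 = u z.1 z.2) :
    ∀ᵐ z ∂(volume.restrict (Iio (0 : ℝ) ×ˢ (univ : Set (EuclideanSpace ℝ (Fin 3))))),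
      nsRescale c (nsRescale lam u) z.1 z.2 = nsRescale lam u z.1 z.2 := by
  have ht := rlNearIdentityDSS_ae_comp_dilation (F := fun z => nsRescale c u z.1 z.2)
    (G := fun z => u z.1 z.2) hlam h
  filter_upwards [ht] with z hz
  rw [nsRescale_comm c lam u, nsRescale_apply, hz, ← nsRescale_apply]

/-- **A rescaled limit is again a limit of the same sequence.**  If `u_c = u` a.e. on the slab
(`c > 0`), `λₙ > 0` and `u_{λₙ} → v` in every `L³(Q(0, R))`, then also `u_{λₙ} → v_c` in every
`L³(Q(0, R))`: on the ball `u_{λₙ} = (u_{λₙ})_c` a.e. (`prSL_ae_nsRescale_comm_of_ae`, the balls lie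
in the slab), and `‖(u_{λₙ})_c − v_c‖_{L³(Q(0,R))} = c (c⁵)^{-1/3} ‖u_{λₙ} − v‖_{L³(Q(0, cR))}` by the
exact scaling law of `L³` distances. [folklore] -/
theorem prSL_tendsto_sub_nsRescale
    {u v : ℝ → EuclideanSpace ℝ (Fin 3) → EuclideanSpace ℝ (Fin 3)} {lam : ℕ → ℝ} {c : ℝ}
    (hlam : ∀ n, 0 < lam n) (hc : 0 < c)
    (hconv : ∀ R : ℝ, 0 < R → Tendsto (fun n => eLpNorm (uncurry (nsRescale (lam n) u) - uncurry v) 3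
      (volume.restrict (parabolicCylinder R (0 : ℝ × EuclideanSpace ℝ (Fin 3))))) atTop (𝓝 0))
    (hfix : ∀ᵐ z ∂(volume.restrict (Iio (0 : ℝ) ×ˢ (univ : Set (EuclideanSpace ℝ (Fin 3))))),
      nsRescale c u z.1 z.2 = u z.1 z.2)
    {R : ℝ} (hR : 0 < R) :
    Tendsto (fun n => eLpNorm (uncurry (nsRescale (lam n) u) - uncurry (nsRescale c v)) 3
      (volume.restrict (parabolicCylinder R (0 : ℝ × EuclideanSpace ℝ (Fin 3))))) atTop (𝓝 0) := by
  set μR : Measure (ℝ × EuclideanSpace ℝ (Fin 3)) :=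
    volume.restrict (parabolicCylinder R (0 : ℝ × EuclideanSpace ℝ (Fin 3))) with hμR
  -- `u_{λ_n} = (u_{λ_n})_c` a.e. on the ball
  have hae : ∀ n, (uncurry (nsRescale (lam n) u) : ℝ × EuclideanSpace ℝ (Fin 3) → EuclideanSpace ℝ (Fin 3))
      =ᵐ[μR] uncurry (nsRescale c (nsRescale (lam n) u)) := by
    intro n
    have h := ae_restrict_of_ae_restrict_of_subset (parabolicCylinder_origin_subset_slab R)
      (prSL_ae_nsRescale_comm_of_ae (c := c) (hlam n) hfix)
    filter_upwards [h] with z hz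
    exact hz.symm
  -- the exact scaling law, term by term
  have heq : ∀ n, eLpNorm (uncurry (nsRescale (lam n) u) - uncurry (nsRescale c v)) 3 μR =
      ‖c‖ₑ * (ENNReal.ofReal (c ^ 2 * c ^ 3)⁻¹) ^ (1 / (3 : ℝ≥0∞).toReal) *
        eLpNorm (uncurry (nsRescale (lam n) u) - uncurry v) 3
          (volume.restrict (parabolicCylinder (c * R) (0 : ℝ × EuclideanSpace ℝ (Fin 3)))) := by
    intro n
    have e1 : eLpNorm (uncurry (nsRescale (lam n) u) - uncurry (nsRescale c v)) 3 μR =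
        eLpNorm (uncurry (nsRescale c (nsRescale (lam n) u)) - uncurry (nsRescale c v)) 3 μR :=
      eLpNorm_congr_ae ((hae n).sub (ae_eq_refl _))
    rw [e1, hμR, nsRescale_eq_zoom c (nsRescale (lam n) u), nsRescale_eq_zoom c v,
      eLpNorm_zoom_sub_zoom _ _ hc R]
  refine (tendsto_congr heq).2 ?_
  have h := ENNReal.Tendsto.const_mul (hconv (c * R) (by positivity)) (Or.inr (zoomConst_ne_top c))
    (a := ‖c‖ₑ * (ENNReal.ofReal (c ^ 2 * c ^ 3)⁻¹) ^ (1 / (3 : ℝ≥0∞).toReal))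
  rwa [mul_zero] at h

/-- **`stub_prStabilizerOfLimit` · A.E. SCALING SYMMETRIES PASS TO `L³_loc` LIMITS OF RESCALINGS.**
Let `u, v` lie in `L³(Q(0, R))` for every `R > 0`, `λₙ > 0`, and `u_{λₙ} → v` in every
`L³(Q(0, R))`.  If `u_{e^σ} = u` a.e. on the backward slab `ℝ₋ × ℝ³`, then `v_{e^σ} = v` a.e. on the
slab: with `c = e^σ`, both `v_c` (`prSL_tendsto_sub_nsRescale`) and `v` are limits of the same
sequence `u_{λₙ}` in every `L³(Q(0, n+1))`, and such limits agree a.e. on the slab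
(`ae_eq_lowerHalf_of_tendsto_eLpNorm`; measurability on the balls from the `L³` classes and
`memLp_three_zoom`).  Hence the scaling stabiliser is upper semicontinuous along the `L³_loc` orbit
closure of a Type-I singularity model (setting of Albritton–Barker 2019, §3). [folklore] -/
theorem stub_prStabilizerOfLimit :
    ∀ (u v : ℝ → EuclideanSpace ℝ (Fin 3) → EuclideanSpace ℝ (Fin 3)) (lam : ℕ → ℝ),
      (∀ R : ℝ, 0 < R → MemLp (uncurry u) 3 (volume.restrict (parabolicCylinder R (0 : ℝ × EuclideanSpace ℝ (Fin 3))))) →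
      (∀ R : ℝ, 0 < R → MemLp (uncurry v) 3 (volume.restrict (parabolicCylinder R (0 : ℝ × EuclideanSpace ℝ (Fin 3))))) →
      (∀ n, 0 < lam n) →
      (∀ R : ℝ, 0 < R → Tendsto (fun n => eLpNorm (uncurry (nsRescale (lam n) u) - uncurry v) 3
        (volume.restrict (parabolicCylinder R (0 : ℝ × EuclideanSpace ℝ (Fin 3))))) atTop (𝓝 0)) →
      ∀ σ : ℝ, (∀ᵐ z ∂(volume.restrict (Iio (0 : ℝ) ×ˢ (univ : Set (EuclideanSpace ℝ (Fin 3))))), nsRescale (Real.exp σ) u z.1 z.2 = u z.1 z.2) →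
        ∀ᵐ z ∂(volume.restrict (Iio (0 : ℝ) ×ˢ (univ : Set (EuclideanSpace ℝ (Fin 3))))), nsRescale (Real.exp σ) v z.1 z.2 = v z.1 z.2 := by
  intro u v lam hu hv hlam hconv σ hσ
  have hc : 0 < Real.exp σ := Real.exp_pos σ
  -- measurability of `u_{λ_j}`, `v`, `v_c` on the balls `Q(0, n+1)`
  have hvm : ∀ (n : ℕ) (j : ℕ), AEStronglyMeasurable (uncurry (nsRescale (lam j) u))
      (volume.restrict (parabolicCylinder ((n : ℝ) + 1) (0 : ℝ × EuclideanSpace ℝ (Fin 3)))) := by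
    intro n j
    rw [nsRescale_eq_zoom (lam j) u]
    exact (memLp_three_zoom (hlam j) (hu (lam j * ((n : ℝ) + 1)) (mul_pos (hlam j) (by positivity)))).1
  have hwm : ∀ n : ℕ, AEStronglyMeasurable (uncurry v)
      (volume.restrict (parabolicCylinder ((n : ℝ) + 1) (0 : ℝ × EuclideanSpace ℝ (Fin 3)))) :=
    fun n => (hv ((n : ℝ) + 1) (by positivity)).1
  have hwm' : ∀ n : ℕ, AEStronglyMeasurable (uncurry (nsRescale (Real.exp σ) v))
      (volume.restrict (parabolicCylinder ((n : ℝ) + 1) (0 : ℝ × EuclideanSpace ℝ (Fin 3)))) := by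
    intro n
    rw [nsRescale_eq_zoom (Real.exp σ) v]
    exact (memLp_three_zoom hc (hv (Real.exp σ * ((n : ℝ) + 1)) (by positivity))).1
  -- `u_{λ_j} → v` and `u_{λ_j} → v_c` in every `L³(Q(0, n+1))`
  have h1 : ∀ n : ℕ, Tendsto (fun j => eLpNorm (uncurry (nsRescale (lam j) u) - uncurry v) 3
      (volume.restrict (parabolicCylinder ((n : ℝ) + 1) (0 : ℝ × EuclideanSpace ℝ (Fin 3)))))
      atTop (𝓝 0) := fun n => hconv _ (by positivity)
  have h2 : ∀ n : ℕ, Tendsto (fun j => eLpNorm (uncurry (nsRescale (lam j) u) -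
      uncurry (nsRescale (Real.exp σ) v)) 3
      (volume.restrict (parabolicCylinder ((n : ℝ) + 1) (0 : ℝ × EuclideanSpace ℝ (Fin 3)))))
      atTop (𝓝 0) := fun n => prSL_tendsto_sub_nsRescale (v := v) hlam hc hconv hσ (by positivity)
  -- two `L³_loc` limits of the same sequence agree a.e. on the slab
  have hae := ae_eq_lowerHalf_of_tendsto_eLpNorm (v := fun j => nsRescale (lam j) u)
    (w := nsRescale (Real.exp σ) v) (w' := v) hvm hwm' hwm h2 h1
  filter_upwards [hae] with z hz
  exact hz

end Summit.NavierStokesRegularity.NavierStokesRegularity.Theorems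

end
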